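import Summits.Ventures.PercRepro.CoreRegimesTable

/-!
# PercRepro — regime A at corank `d = 5` for every `p ≥ 201` (p2, gen 11)

The exact table of the regime A / B′ inequalities (NIGHT-1 §13.3; `regimes_all_200.out`, ref-2's `r3check`) has regime A
holding from `d = 5` on for every `170 ≤ p ≤ 260`. THEOREM R3 (`CoreRegimes.lean`) proves the cells `d ≥ 6` for every
`p ≥ 201`; this file adds the cell `d = 5` for every `p ≥ 201`, where the margin is `≈ 0.6 %` at `p = 201` and the crude
cubic ratio of Lemma 2 is not enough: here the EXACT ratio `C(p+5,3)/C(p+3,3) = (p+5)(p+4)/((p+2)(p+1))` is used, and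
the inequality reduces to `(811/210)·(p+5)(p+4) + 1 ≤ 4·(p+2)(p+1)`, i.e. `29p² ≥ 4779p + 14750`, true from `p = 168`.

* `choose_five_mul_eq`: `C(p+5,3)·(p+2)(p+1) = C(p+3,3)·(p+5)(p+4)`; `ten_thousand_pow_nine_le_two_pow'` (from `n = 206`);
* `regimeA_of_five`: `RegimeA p 5` for `p ≥ 201`;
* **`regime_of_five_le`**: `RegimeA p d ∨ RegimeB p d` for every `p ≥ 201`, `d ≥ 5`;
* **`regime_of_le`**: the union of the kernel ranges — `(9 ≤ p ∧ amin p ≤ d) ∨ (201 ≤ p ∧ 5 ≤ d)` ⇒ `RegimeA p d ∨ RegimeB p d`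
  (`CoreRegimesTable` for `9 ≤ p ≤ 62`, `CoreRegimesLow` for `p ≥ 63`, this file for `d = 5` at `p ≥ 201`).
Imports `CoreRegimesTable` (hence `CoreRegimesLow`, `CoreRegimes`). Axioms: standard.
-/

namespace PercRepro
namespace CoreRegimes

open Finset

/-- The exact cubic ratio at `d = 5`: `C(p+5,3)·(p+2)(p+1) = C(p+3,3)·(p+5)(p+4)`. -/
theorem choose_five_mul_eq (p : ℕ) :
    Nat.choose (p + 5) 3 * ((p + 2) * (p + 1)) = Nat.choose (p + 3) 3 * ((p + 5) * (p + 4)) := by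
  have h1 := six_mul_choose_three (p + 3)
  have h2 := six_mul_choose_three (p + 1)
  rw [show p + 3 + 2 = p + 5 by omega] at h1
  rw [show p + 1 + 2 = p + 3 by omega] at h2
  have : 6 * (Nat.choose (p + 5) 3 * ((p + 2) * (p + 1))) = 6 * (Nat.choose (p + 3) 3 * ((p + 5) * (p + 4))) := by
    calc 6 * (Nat.choose (p + 5) 3 * ((p + 2) * (p + 1))) = (6 * Nat.choose (p + 5) 3) * ((p + 2) * (p + 1)) := by ring
      _ = ((p + 5) * (p + 4) * (p + 3)) * ((p + 2) * (p + 1)) := by rw [h1]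
      _ = ((p + 3) * (p + 2) * (p + 1)) * ((p + 5) * (p + 4)) := by ring
      _ = (6 * Nat.choose (p + 3) 3) * ((p + 5) * (p + 4)) := by rw [h2]
      _ = 6 * (Nat.choose (p + 3) 3 * ((p + 5) * (p + 4))) := by ring
  exact Nat.eq_of_mul_eq_mul_left (by norm_num) this

/-- `10⁴·n⁹ ≤ 2ⁿ` from `n = 206` on (the landed lemma starts at `207`; `n = 206` is `p = 201`, `d = 5`). -/
theorem ten_thousand_pow_nine_le_two_pow' (n : ℕ) (hn : 206 ≤ n) : 10000 * n ^ 9 ≤ 2 ^ n := by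
  rcases Nat.lt_or_ge n 207 with h | h
  · have : n = 206 := by omega
    subst this
    norm_num
  · exact ten_thousand_pow_nine_le_two_pow n h

/-- The polynomial part at `d = 5`: `(4·C(n,3) + Σ_{j≤5} C(n,j))·(p+2)(p+1) ≤ 2^{p+3}` for `n = p + 5`, `p ≥ 201`. -/
theorem poly_part_le (p : ℕ) (hp : 201 ≤ p) :
    (4 * Nat.choose (p + 5) 3 + ∑ j ∈ range (5 + 1), Nat.choose (p + 5) j) * ((p + 2) * (p + 1)) ≤ 2 ^ (p + 3) := by
  have hn : 206 ≤ p + 5 := by omega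
  have hpos5 : 0 < p + 5 := by omega
  have h1 : Nat.choose (p + 5) 3 ≤ (p + 5) ^ 5 :=
    (Nat.choose_le_pow (p + 5) 3).trans (Nat.pow_le_pow_right hpos5 (by norm_num))
  have h2 : ∑ j ∈ range (5 + 1), Nat.choose (p + 5) j ≤ 6 * (p + 5) ^ 5 := by
    calc ∑ j ∈ range (5 + 1), Nat.choose (p + 5) j ≤ ∑ j ∈ range (5 + 1), (p + 5) ^ 5 := by
          apply sum_le_sum
          intro j hj
          simp only [mem_range] at hj
          exact (Nat.choose_le_pow (p + 5) j).trans (Nat.pow_le_pow_right hpos5 (by omega))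
      _ = 6 * (p + 5) ^ 5 := by simp
  have h3 : (p + 2) * (p + 1) ≤ (p + 5) ^ 2 := by nlinarith
  have h4 := ten_thousand_pow_nine_le_two_pow' (p + 5) hn
  have h5 : 10 * (p + 5) ^ 7 ≤ (p + 5) ^ 9 := by
    have : 10 ≤ (p + 5) ^ 2 := by nlinarith
    calc 10 * (p + 5) ^ 7 ≤ (p + 5) ^ 2 * (p + 5) ^ 7 := Nat.mul_le_mul_right _ this
      _ = (p + 5) ^ 9 := by ring
  have h6 : (p + 5) ^ 9 ≤ 2 ^ (p + 3) := by
    have : 2 ^ (p + 5) = 4 * 2 ^ (p + 3) := by ring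
    rw [this] at h4
    omega
  calc (4 * Nat.choose (p + 5) 3 + ∑ j ∈ range (5 + 1), Nat.choose (p + 5) j) * ((p + 2) * (p + 1))
      ≤ (4 * (p + 5) ^ 5 + 6 * (p + 5) ^ 5) * (p + 5) ^ 2 := by gcongr
    _ = 10 * (p + 5) ^ 7 := by ring
    _ ≤ (p + 5) ^ 9 := h5
    _ ≤ 2 ^ (p + 3) := h6

/-- **Regime A at `d = 5`** for every `p ≥ 201`: the exact ratio `(p+5)(p+4)/((p+2)(p+1))` and
`(811/210)·(p+5)(p+4) + 1 ≤ 4·(p+2)(p+1)`. -/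
theorem regimeA_of_five (p : ℕ) (hp : 201 ≤ p) : RegimeA p 5 := by
  unfold RegimeA
  have hL := lhsU_le p 5 (by omega)
  have hphi := phiK_three_mul_choose_le p
  have hphi0 := phiK_three_nonneg p
  have hratio : (Nat.choose (p + 5) 3 : ℚ) * (((p : ℚ) + 2) * ((p : ℚ) + 1))
      = (Nat.choose (p + 3) 3 : ℚ) * (((p : ℚ) + 5) * ((p : ℚ) + 4)) := by
    have := choose_five_mul_eq p
    exact_mod_cast this
  have hpoly : (4 * (Nat.choose (p + 5) 3 : ℚ) + ∑ j ∈ range (5 + 1), (Nat.choose (p + 5) j : ℚ))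
      * (((p : ℚ) + 2) * ((p : ℚ) + 1)) ≤ (2 : ℚ) ^ (p + 3) := by
    have := poly_part_le p hp
    exact_mod_cast this
  have hquad : (811 / 210 : ℚ) * (((p : ℚ) + 5) * ((p : ℚ) + 4)) + 1 ≤ 4 * (((p : ℚ) + 2) * ((p : ℚ) + 1)) := by
    have : (201 : ℚ) ≤ p := by exact_mod_cast hp
    nlinarith
  have hpos : (0 : ℚ) < ((p : ℚ) + 2) * ((p : ℚ) + 1) := by positivity
  have hX : (0 : ℚ) ≤ (2 : ℚ) ^ (p + 3) := by positivity
  have hPC : phiK p 3 * (Nat.choose (p + 5) 3 : ℚ) * (((p : ℚ) + 2) * ((p : ℚ) + 1))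
      ≤ (2 : ℚ) ^ (p + 3) * (((p : ℚ) + 5) * ((p : ℚ) + 4)) := by
    calc phiK p 3 * (Nat.choose (p + 5) 3 : ℚ) * (((p : ℚ) + 2) * ((p : ℚ) + 1))
        = phiK p 3 * ((Nat.choose (p + 5) 3 : ℚ) * (((p : ℚ) + 2) * ((p : ℚ) + 1))) := by ring
      _ = phiK p 3 * ((Nat.choose (p + 3) 3 : ℚ) * (((p : ℚ) + 5) * ((p : ℚ) + 4))) := by rw [hratio]
      _ = (phiK p 3 * (Nat.choose (p + 3) 3 : ℚ)) * (((p : ℚ) + 5) * ((p : ℚ) + 4)) := by ring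
      _ ≤ (2 : ℚ) ^ (p + 3) * (((p : ℚ) + 5) * ((p : ℚ) + 4)) := by
          apply mul_le_mul_of_nonneg_right hphi
          positivity
  set Q : ℚ := ((p : ℚ) + 2) * ((p : ℚ) + 1) with hQ
  set X : ℚ := (2 : ℚ) ^ (p + 3) with hX_def
  set PC : ℚ := phiK p 3 * (Nat.choose (p + 5) 3 : ℚ) with hPC_def
  set C : ℚ := (Nat.choose (p + 5) 3 : ℚ) with hC_def
  set T : ℚ := ∑ j ∈ range (5 + 1), (Nat.choose (p + 5) j : ℚ) with hT_def
  set V : ℚ := ((p : ℚ) + 5) * ((p : ℚ) + 4) with hV_def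
  have h1 : lhsU p 5 * Q ≤ (alphaP * PC + 4 * C) * Q := mul_le_mul_of_nonneg_right hL hpos.le
  have h2 : alphaP * (PC * Q) ≤ alphaP * (X * V) := by
    apply mul_le_mul_of_nonneg_left hPC
    unfold alphaP; norm_num
  have h4 : X * ((811 / 210) * V + 1) ≤ X * (4 * Q) := mul_le_mul_of_nonneg_left hquad hX
  have h5 : (2 : ℚ) ^ (p + 5) = 4 * X := by rw [hX_def]; ring
  have hfinal : (lhsU p 5 + T) * Q ≤ (2 : ℚ) ^ (p + 5) * Q := by
    rw [h5]
    unfold alphaP at h1 h2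
    nlinarith [h1, h2, h4, hpoly]
  exact le_of_mul_le_mul_right hfinal hpos

/-- **THEOREM R3 extended to `d ≥ 5`**: for every `p ≥ 201` and every `d ≥ 5`, regime A or regime B′ holds. -/
theorem regime_of_five_le (p d : ℕ) (hp : 201 ≤ p) (hd : 5 ≤ d) : RegimeA p d ∨ RegimeB p d := by
  rcases Nat.lt_or_ge d 6 with h | h
  · have : d = 5 := by omega
    subst this
    exact Or.inl (regimeA_of_five p hp)
  · exact regime_of_six_le p d hp h


/-- **THE KERNEL RANGE OF THEOREM R3**: regime A or regime B′ holds on every cell with `p ≥ 9, d ≥ amin p`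
(`amin = 8, 7, 7, 7, 6, 6, …`) or `p ≥ 201, d ≥ 5`. -/
theorem regime_of_le (p d : ℕ) (hpd : (9 ≤ p ∧ amin p ≤ d) ∨ (201 ≤ p ∧ 5 ≤ d)) : RegimeA p d ∨ RegimeB p d := by
  rcases hpd with ⟨hp, hd⟩ | ⟨hp, hd⟩
  · exact regime_of_amin p d hp hd
  · exact regime_of_five_le p d hp hd

end CoreRegimes
end PercRepro
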